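import Summits.AnomalousDissipation.AnomalousDissipation.Theorems.BaireTransferRobustLoudUpgradeLineLeaf
import Literature.Analysis.FluidPDE.SteadyNSLatticePersistenceDrift

/-!
# Stub `stub_steadyPersistLeaf` of the line `malkin-cone-group-orbits` (crux stmt-AnomalousDissipation-1144):
# `nondegSteadyLeaf S a E ε ⊆ persistSteadyLeaf S a E ε`

Registered signature (proved here, textually):
`theorem stub_steadyPersistLeaf : ∀ (S : Finset (Fin 3 → ℤ)) (a E ε : ℝ), nondegSteadyLeaf S a E ε ⊆ persistSteadyLeaf S a E ε`.

A leaf-nondegenerate loud classical steady witness `u₀` of ANY mean (class `nondegSteadyLeaf` of the companion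
vocabulary module `…LineLeaf.lean`, reshape v4) persists in its conserved-mean leaf under small changes of the
force coefficients at the same viscosity: this is verbatim the Literature theorem
`Literature.Analysis.FluidPDE.SteadyLatticeDrift.steadyPersistsInLeaf_of_nondeg` (Temam 1979 Ch. II §1, Thm. 1.3;
Foias–Temam 1977 §1; Saut–Temam 1980 §2, run for the drifted steady system), whose hypotheses and conclusion are
the unfoldings of `force` / `h1DistSq` / `SteadyPersistsInLeaf`.  Pure proof file (no definitions).
-/

-- `Summit.<Summit>.<Problem>` is the tree's mandated summit-side namespace (CONVENTIONS §2); for this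
-- single-conjunct summit the two coincide, so the duplicate is deliberate.
set_option linter.dupNamespace false

noncomputable section

open scoped BigOperators Topology
open Filter Set Function TopologicalSpace MeasureTheory

namespace Summit.AnomalousDissipation.AnomalousDissipation.Theorems.RobustLoudUpgrade.SteadyPersistLeaf

open Literature.Analysis.FunctionSpaces Literature.Analysis.FunctionSpaces.Torus
open Literature.Analysis.FluidPDE
open Summit.AnomalousDissipation.AnomalousDissipation.Theses.BaireTransfer

/-- **The registered stub `stub_steadyPersistLeaf`**: leaf-nondegenerate loud steady witnesses of any mean are
leaf-persistent (`nondegSteadyLeaf ⊆ persistSteadyLeaf`), by the conserved-mean steady implicit function theorem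
`SteadyLatticeDrift.steadyPersistsInLeaf_of_nondeg` at the witness's own viscosity. [folklore] -/
theorem stub_steadyPersistLeaf : ∀ (S : Finset (Fin 3 → ℤ)) (a E ε : ℝ), nondegSteadyLeaf S a E ε ⊆ persistSteadyLeaf S a E ε := by
  intro S a E ε c hc
  obtain ⟨ν, hν, hνa, u₀, p₀, hst, hE, hε, hnd⟩ := hc
  exact ⟨ν, hν, hνa, u₀, p₀, hst, hE, hε, SteadyLatticeDrift.steadyPersistsInLeaf_of_nondeg hν hst hnd⟩

end Summit.AnomalousDissipation.AnomalousDissipation.Theorems.RobustLoudUpgrade.SteadyPersistLeaf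

end
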